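import Mathlib
import Summits.Ventures.HodgeRepro2.T5DegreeOneQuotient

/-!
# T5DegreeOnePadicInt — the embedding `R →+* ℤ_[p]` at a degree-one prime

Tier-5 kernel support (seat p7), file (2) of the chain behind route/T5-LEAN-p7.md §22 (fourth
addendum), «the completion of `F` at a degree-one prime `𝔭` is `ℚ_p`»: with the finite layers
`R ⧸ P ^ n ≃+* ZMod (p ^ n)` of `T5DegreeOneQuotient` in hand, Mathlib's universal property of
`ℤ_[p]` as the projective limit of the `ZMod (p ^ n)` (`PadicInt.lift`) produces a ring map
`toPadicInt : R →+* ℤ_[p]` which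
* restricts to the identity on `ℤ` (`toPadicInt_intCast`),
* turns the `P`-adic filtration into the `p`-adic one: `x ∈ P ^ n ↔ ‖toPadicInt x‖ ≤ p⁻ⁿ`
  (`mem_pow_iff_norm_toPadicInt_le`),
* is injective (Krull's intersection theorem, `Ideal.iInf_pow_eq_bot_of_isDomain`), and
* has dense range (`ℤ` is already dense in `ℤ_[p]`, `PadicInt.denseRange_intCast`).

Setting and hypotheses as in `T5DegreeOneQuotient`: `R` a Dedekind domain, `P` a non-zero prime,
`p` a rational prime, `(p : R) ∈ P`, `(p : R) ∉ P ^ 2` (`e = 1`), `ℤ → R ⧸ P` surjective (`f = 1`).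
Definitions: `toZModPowHom` (the compatible family) and `toPadicInt`. Mathlib only otherwise.
-/

namespace Summit.Ventures.HodgeRepro2.T5DegreeOnePadicInt

open Ideal IsDedekindDomain Summit.Ventures.HodgeRepro2.T5DegreeOneQuotient

variable {R : Type*} [CommRing R] [IsDedekindDomain R] {P : Ideal R} [hP : P.IsPrime] {p : ℕ}
  [hp : Fact p.Prime] (hP0 : P ≠ ⊥) (hpP : (p : R) ∈ P) (hpP2 : (p : R) ∉ P ^ 2)
  (hsurj : ∀ x : R, ∃ a : ℤ, x - a ∈ P)
include hP0 hpP hpP2 hsurj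

/-- The compatible family `R →+* ZMod (p ^ n)`: reduction modulo `P ^ n` followed by the
isomorphism `quotPowEquivZMod n : R ⧸ P ^ n ≃+* ZMod (p ^ n)`. -/
noncomputable def toZModPowHom (n : ℕ) : R →+* ZMod (p ^ n) :=
  (quotPowEquivZMod hP0 hpP hpP2 hsurj n).toRingHom.comp (Ideal.Quotient.mk (P ^ n))

/-- `toZModPowHom` is reduction modulo `p ^ n` on rational integers. -/
theorem toZModPowHom_intCast (n : ℕ) (a : ℤ) :
    toZModPowHom hP0 hpP hpP2 hsurj n (a : R) = (a : ZMod (p ^ n)) := by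
  simp [toZModPowHom]

/-- If `x ≡ a (mod P ^ n)` with `a : ℤ`, then `toZModPowHom n x = a`. -/
theorem toZModPowHom_eq_intCast_of_sub_mem {n : ℕ} {x : R} {a : ℤ} (h : x - a ∈ P ^ n) :
    toZModPowHom hP0 hpP hpP2 hsurj n x = (a : ZMod (p ^ n)) := by
  rw [← toZModPowHom_intCast hP0 hpP hpP2 hsurj n a]
  simp only [toZModPowHom, RingHom.comp_apply]
  congr 1
  exact Ideal.Quotient.eq.mpr h

/-- The kernel of `toZModPowHom n` is `P ^ n`. -/
theorem toZModPowHom_eq_zero_iff (n : ℕ) (x : R) :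
    toZModPowHom hP0 hpP hpP2 hsurj n x = 0 ↔ x ∈ P ^ n := by
  simp [toZModPowHom, Ideal.Quotient.eq_zero_iff_mem]

/-- The family `toZModPowHom` is compatible with the reduction maps `ZMod (p ^ k₂) → ZMod (p ^ k₁)`,
in exactly the form `PadicInt.lift` requires. -/
theorem toZModPowHom_compat (k₁ k₂ : ℕ) (hk : k₁ ≤ k₂) :
    (ZMod.castHom (pow_dvd_pow p hk) (ZMod (p ^ k₁))).comp (toZModPowHom hP0 hpP hpP2 hsurj k₂) =
      toZModPowHom hP0 hpP hpP2 hsurj k₁ := by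
  ext x
  obtain ⟨a, ha⟩ := exists_int_sub_mem_pow hP0 hpP hpP2 hsurj k₂ x
  have ha₁ : x - a ∈ P ^ k₁ := Ideal.pow_le_pow_right hk ha
  rw [RingHom.comp_apply, toZModPowHom_eq_intCast_of_sub_mem hP0 hpP hpP2 hsurj ha,
    toZModPowHom_eq_intCast_of_sub_mem hP0 hpP hpP2 hsurj ha₁, map_intCast]

/-- THE EMBEDDING `R →+* ℤ_[p]` at a degree-one prime: Mathlib's `PadicInt.lift` (the universal
property of `ℤ_[p]` as the projective limit of the `ZMod (p ^ n)`) applied to the compatible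
family `toZModPowHom`. -/
noncomputable def toPadicInt : R →+* ℤ_[p] :=
  PadicInt.lift (toZModPowHom_compat hP0 hpP hpP2 hsurj)

/-- `toPadicInt` followed by reduction modulo `p ^ n` is `toZModPowHom n` (`PadicInt.lift_spec`). -/
theorem toZModPow_toPadicInt (n : ℕ) (x : R) :
    PadicInt.toZModPow n (toPadicInt hP0 hpP hpP2 hsurj x) = toZModPowHom hP0 hpP hpP2 hsurj n x :=
  RingHom.congr_fun (PadicInt.lift_spec (toZModPowHom_compat hP0 hpP hpP2 hsurj) n) x

/-- `toPadicInt` is the identity on rational integers (as any ring map is). -/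
theorem toPadicInt_intCast (a : ℤ) : toPadicInt hP0 hpP hpP2 hsurj (a : R) = (a : ℤ_[p]) :=
  map_intCast _ a

/-- `toPadicInt` is the identity on natural numbers. -/
theorem toPadicInt_natCast (a : ℕ) : toPadicInt hP0 hpP hpP2 hsurj (a : R) = (a : ℤ_[p]) :=
  map_natCast _ a

/-- The `P`-adic filtration of `R` is the `p`-adic filtration of `ℤ_[p]`:
`x ∈ P ^ n ↔ ‖toPadicInt x‖ ≤ p⁻ⁿ`. -/
theorem mem_pow_iff_norm_toPadicInt_le (n : ℕ) (x : R) :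
    x ∈ P ^ n ↔ ‖toPadicInt hP0 hpP hpP2 hsurj x‖ ≤ (p : ℝ) ^ (-(n : ℤ)) := by
  rw [PadicInt.norm_le_pow_iff_mem_span_pow, ← PadicInt.ker_toZModPow, RingHom.mem_ker,
    toZModPow_toPadicInt, toZModPowHom_eq_zero_iff]

/-- `x ∈ P ^ n ↔ toPadicInt x ∈ (p ^ n)`. -/
theorem mem_pow_iff_toPadicInt_mem_span (n : ℕ) (x : R) :
    x ∈ P ^ n ↔ toPadicInt hP0 hpP hpP2 hsurj x ∈ Ideal.span {(p : ℤ_[p]) ^ n} := by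
  rw [mem_pow_iff_norm_toPadicInt_le hP0 hpP hpP2 hsurj n x, PadicInt.norm_le_pow_iff_mem_span_pow]

/-- `toPadicInt` is injective: an element of every `P ^ n` is `0` (Krull's intersection theorem
in the Noetherian domain `R`, `Ideal.iInf_pow_eq_bot_of_isDomain`). -/
theorem toPadicInt_injective : Function.Injective (toPadicInt hP0 hpP hpP2 hsurj) := by
  rw [injective_iff_map_eq_zero]
  intro x hx
  have hmem : ∀ n : ℕ, x ∈ P ^ n := fun n => by
    rw [mem_pow_iff_norm_toPadicInt_le hP0 hpP hpP2 hsurj, hx, norm_zero]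
    exact le_of_lt (zpow_pos (by exact_mod_cast hp.out.pos) _)
  have hbot : (⨅ n : ℕ, P ^ n) = ⊥ := Ideal.iInf_pow_eq_bot_of_isDomain P hP.ne_top
  have hx' : x ∈ ⨅ n : ℕ, P ^ n := Submodule.mem_iInf _ |>.mpr hmem
  rwa [hbot, Ideal.mem_bot] at hx'

/-- The range of `toPadicInt` is dense in `ℤ_[p]` (it contains `ℤ`, which is dense:
`PadicInt.denseRange_intCast`). -/
theorem denseRange_toPadicInt : DenseRange (toPadicInt hP0 hpP hpP2 hsurj) := by
  have h : Set.range (Int.cast : ℤ → ℤ_[p]) ⊆ Set.range (toPadicInt hP0 hpP hpP2 hsurj) := by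
    rintro _ ⟨a, rfl⟩
    exact ⟨(a : R), toPadicInt_intCast hP0 hpP hpP2 hsurj a⟩
  exact Dense.mono h PadicInt.denseRange_intCast

/-- The norm of `toPadicInt x` is at most `1` (it is a `p`-adic integer) and it is `< 1` iff `x ∈ P`. -/
theorem norm_toPadicInt_lt_one_iff (x : R) :
    ‖toPadicInt hP0 hpP hpP2 hsurj x‖ < 1 ↔ x ∈ P := by
  have h := mem_pow_iff_norm_toPadicInt_le hP0 hpP hpP2 hsurj 1 x
  rw [pow_one] at h
  rw [h, PadicInt.norm_le_pow_iff_norm_lt_pow_add_one]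
  norm_num

end Summit.Ventures.HodgeRepro2.T5DegreeOnePadicInt
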